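import Literature.Geometry.Symplectic.SteinDomain
import Mathlib.Geometry.Manifold.BumpFunction
import Mathlib.Geometry.Manifold.VectorBundle.ContMDiffSection
import Mathlib.Geometry.Manifold.ContMDiffMFDeriv
import HarnessLib

/-!
# The almost complex structure of a Stein domain as a continuous bundle map `TW → TW`

Topic `Literature/Geometry/Symplectic`.  `SteinStructure.J_smooth` (`SteinDomain.lean`) records
the smoothness of the almost complex structure `J` of a Stein domain `W` in the operator form
*"`J` maps smooth vector fields to smooth vector fields"*.  This file extracts from it the
point-set statements that the contact-geometric layer (`SteinBoundaryContact.lean`: the contact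
form `α = -dφ ∘ J`, twisting numbers of framings) needs:

* `contMDiffAt_J_symmL` — in the trivialization of `TW` over a chart domain, `J` applied to the
  constant local sections `x ↦ e.symmL x w` is a smooth vector field on the chart domain (bump
  function globalisation `ContMDiffOn.smul_section_of_tsupport` + `J_smooth`);
* `JTriv J x₀ x w` — the matrix of `J` in the trivialization at `x₀`, and its smoothness
  `contMDiffAt_JTriv` in `x` on the chart domain, for every `w`;
* `continuous_Jbundle` — **`(x, v) ↦ (x, J_x v)` is a continuous map `TW → TW`**, and the
  parametrised corollary `ContinuousWithinAt.J_bundle` (a continuous family of tangent vectors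
  stays continuous after applying `J`).

Everything is proved, for any field of endomorphisms `J` preserving smooth vector fields
(hypothesis `PreservesSmoothFields J`), in particular for `S.J`, `S : SteinStructure W`.

## References

* K. Cieliebak, Ya. Eliashberg, *From Stein to Weinstein and back*, AMS Coll. Publ. 59 (2012),
  Ch. 2 (almost complex structures as bundle endomorphisms). [CieliebakEliashberg2012]
* R. E. Gompf, Ann. of Math. 148 (1998), §1. [Gompf1998]
-/

noncomputable section

open scoped Manifold ContDiff Topology Bundle
open Set Function Bundle

namespace Literature.Geometry.Symplectic

/-- The model vector space `ℝ⁴` of the tangent spaces. [folklore] -/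
local notation "E4" => EuclideanSpace ℝ (Fin 4)

variable {W : Type*} [TopologicalSpace W] [ChartedSpace (EuclideanHalfSpace 4) W]

/-- **`J` preserves smooth vector fields** — the smoothness axiom `SteinStructure.J_smooth` of an
almost complex structure, as a predicate on a field of endomorphisms `J x : T_xW → T_xW`.
[cite: Gompf1998, §1] -/
def PreservesSmoothFields [IsManifold (𝓡∂ 4) ∞ W] (J : (x : W) → (E4 →L[ℝ] E4)) : Prop :=
  ∀ X : (x : W) → TangentSpace (𝓡∂ 4) x,
    IsSmoothVectorField W X → IsSmoothVectorField W fun x => J x (X x)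

/-- A Stein structure's `J` preserves smooth vector fields (its axiom `J_smooth`). [folklore] -/
theorem SteinStructure.preservesSmoothFields [IsManifold (𝓡∂ 4) ∞ W] [CompactSpace W]
    (S : SteinStructure W) : PreservesSmoothFields S.J :=
  S.J_smooth

/-! ### The constant local sections of a trivialization are smooth -/

section Triv

variable [IsManifold (𝓡∂ 4) ∞ W]

/-- **The local sections `x ↦ e.symmL x w` of the trivialization `e` of `TW` at `x₀` are smooth
on the chart domain of `x₀`** (in `e` they read as the constant `w`). [folklore] -/
theorem contMDiffOn_symmL_trivializationAt (x₀ : W) (w : E4) :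
    ContMDiffOn (𝓡∂ 4) ((𝓡∂ 4).prod 𝓘(ℝ, E4)) ∞
      (fun x => (TotalSpace.mk' E4 x
        ((trivializationAt E4 (TangentSpace (𝓡∂ 4)) x₀).symmL ℝ x w) : TangentBundle (𝓡∂ 4) W))
      (chartAt (EuclideanHalfSpace 4) x₀).source := by
  set e := trivializationAt E4 (TangentSpace (𝓡∂ 4)) x₀ with he
  have hb : e.baseSet = (chartAt (EuclideanHalfSpace 4) x₀).source := rfl
  rw [← hb, e.contMDiffOn_section_baseSet_iff]
  refine (contMDiffOn_const (c := w)).congr fun x hx => ?_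
  show (e ⟨x, e.symmL ℝ x w⟩).2 = w
  rw [e.symmL_apply hx, e.apply_mk_symm hx]

variable [T2Space W]

/-- **`J` of a constant local section is smooth on the chart domain.**  For `x₁` in the chart
domain of `x₀`, cut the local section `x ↦ e.symmL x w` off by a smooth bump function at `x₁`
supported in the chart domain (`SmoothBumpFunction`, `ContMDiffOn.smul_section_of_tsupport`):
the result is a global smooth vector field, to which `J` applies (`PreservesSmoothFields`), and
it agrees with the local section near `x₁`. [folklore] -/
theorem contMDiffAt_J_symmL {J : (x : W) → (E4 →L[ℝ] E4)} (hJ : PreservesSmoothFields J)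
    (x₀ : W) (w : E4) {x₁ : W} (hx₁ : x₁ ∈ (chartAt (EuclideanHalfSpace 4) x₀).source) :
    ContMDiffAt (𝓡∂ 4) ((𝓡∂ 4).prod 𝓘(ℝ, E4)) ∞
      (fun x => (TotalSpace.mk' E4 x
        (J x ((trivializationAt E4 (TangentSpace (𝓡∂ 4)) x₀).symmL ℝ x w)) :
          TangentBundle (𝓡∂ 4) W)) x₁ := by
  set e := trivializationAt E4 (TangentSpace (𝓡∂ 4)) x₀ with he
  -- a bump function at `x₁` supported in the chart domain of `x₀`
  have hU : (chartAt (EuclideanHalfSpace 4) x₀).source ∈ 𝓝 x₁ :=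
    (chartAt _ x₀).open_source.mem_nhds hx₁
  obtain ⟨χ, hχ, -⟩ := (SmoothBumpFunction.nhds_basis_support (I := 𝓡∂ 4) hU).mem_iff.1 hU
  -- the cut-off section is a global smooth vector field
  set s : (x : W) → TangentSpace (𝓡∂ 4) x := fun x => e.symmL ℝ x w with hs
  have hsm : IsSmoothVectorField W ((χ : W → ℝ) • s) :=
    ContMDiffOn.smul_section_of_tsupport χ.contMDiff.contMDiffOn (chartAt _ x₀).open_source hχ
      (contMDiffOn_symmL_trivializationAt x₀ w)
  have hJs := hJ _ hsm x₁
  -- near `x₁` the bump function is `1`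
  refine hJs.congr_of_eventuallyEq ?_
  filter_upwards [χ.eventuallyEq_one] with x hx
  show (⟨x, J x (e.symmL ℝ x w)⟩ : TangentBundle (𝓡∂ 4) W) =
    ⟨x, J x ((χ : W → ℝ) x • e.symmL ℝ x w)⟩
  rw [hx, Pi.one_apply, one_smul]

/-- **The matrix of `J` in the trivialization of `TW` at `x₀`**: the endomorphism
`e_x ∘ J_x ∘ e_x⁻¹` of the model fibre `E4` (`e` the trivialization at `x₀`, `e_x` its fibre map
at `x`; junk outside the chart domain of `x₀`). [folklore] -/
def JTriv (J : (x : W) → (E4 →L[ℝ] E4)) (x₀ x : W) : E4 →L[ℝ] E4 :=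
  ((trivializationAt E4 (TangentSpace (𝓡∂ 4)) x₀).continuousLinearMapAt ℝ x).comp
    ((J x).comp ((trivializationAt E4 (TangentSpace (𝓡∂ 4)) x₀).symmL ℝ x))

omit [T2Space W] in
/-- Unfolding `JTriv` on the chart domain: `JTriv J x₀ x w = (e ⟨x, J_x (e.symmL x w)⟩).2`.
[folklore] -/
theorem JTriv_apply (J : (x : W) → (E4 →L[ℝ] E4)) {x₀ x : W}
    (hx : x ∈ (chartAt (EuclideanHalfSpace 4) x₀).source) (w : E4) :
    JTriv J x₀ x w = ((trivializationAt E4 (TangentSpace (𝓡∂ 4)) x₀)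
      ⟨x, J x ((trivializationAt E4 (TangentSpace (𝓡∂ 4)) x₀).symmL ℝ x w)⟩).2 := by
  simp only [JTriv, ContinuousLinearMap.coe_comp, Function.comp_apply]
  exact (trivializationAt E4 (TangentSpace (𝓡∂ 4)) x₀).continuousLinearMapAt_apply_of_mem ℝ hx _

omit [T2Space W] in
/-- **`J` read in the trivialization**: for `x` in the chart domain of `x₀` and `v ∈ T_xW`,
`(e ⟨x, J_x v⟩).2 = JTriv J x₀ x (e ⟨x, v⟩).2`. [folklore] -/
theorem trivializationAt_J_apply (J : (x : W) → (E4 →L[ℝ] E4)) {x₀ x : W}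
    (hx : x ∈ (chartAt (EuclideanHalfSpace 4) x₀).source) (v : E4) :
    ((trivializationAt E4 (TangentSpace (𝓡∂ 4)) x₀) (⟨x, J x v⟩ : TangentBundle (𝓡∂ 4) W)).2 =
      JTriv J x₀ x ((trivializationAt E4 (TangentSpace (𝓡∂ 4)) x₀)
        (⟨x, v⟩ : TangentBundle (𝓡∂ 4) W)).2 := by
  set e := trivializationAt E4 (TangentSpace (𝓡∂ 4)) x₀ with he
  have h : J x v = J x (e.symmL ℝ x (e (⟨x, v⟩ : TangentBundle (𝓡∂ 4) W)).2) := by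
    rw [e.symmL_apply hx, e.symm_apply_apply_mk hx]
  rw [JTriv_apply J hx, ← h]

/-- **Smoothness of the matrix entries of `J`**: `x ↦ JTriv J x₀ x w` is `C^∞` at every point of
the chart domain of `x₀`. [folklore] -/
theorem contMDiffAt_JTriv {J : (x : W) → (E4 →L[ℝ] E4)} (hJ : PreservesSmoothFields J)
    (x₀ : W) (w : E4) {x₁ : W} (hx₁ : x₁ ∈ (chartAt (EuclideanHalfSpace 4) x₀).source) :
    ContMDiffAt (𝓡∂ 4) 𝓘(ℝ, E4) ∞ (fun x => JTriv J x₀ x w) x₁ := by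
  set e := trivializationAt E4 (TangentSpace (𝓡∂ 4)) x₀ with he
  have h := contMDiffAt_J_symmL hJ x₀ w hx₁
  rw [e.contMDiffAt_section_iff hx₁] at h
  refine h.congr_of_eventuallyEq ?_
  filter_upwards [(chartAt _ x₀).open_source.mem_nhds hx₁] with x hx
  exact JTriv_apply J hx w

/-- Continuity of the matrix entries of `J` on the chart domain. [folklore] -/
theorem continuousOn_JTriv {J : (x : W) → (E4 →L[ℝ] E4)} (hJ : PreservesSmoothFields J)
    (x₀ : W) (w : E4) :
    ContinuousOn (fun x => JTriv J x₀ x w) (chartAt (EuclideanHalfSpace 4) x₀).source :=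
  fun _ hx => (contMDiffAt_JTriv hJ x₀ w hx).continuousAt.continuousWithinAt

/-! ### `J` as a continuous bundle map -/

/-- **The bundle map `(x, v) ↦ (x, J_x v)` of `TW`.** [folklore] -/
def Jbundle (J : (x : W) → (E4 →L[ℝ] E4)) (p : TangentBundle (𝓡∂ 4) W) : TangentBundle (𝓡∂ 4) W :=
  ⟨p.proj, J p.proj p.2⟩

omit [IsManifold (𝓡∂ 4) ∞ W] [T2Space W] in
/-- `Jbundle` preserves base points. [folklore] -/
@[simp] theorem Jbundle_proj (J : (x : W) → (E4 →L[ℝ] E4)) (p : TangentBundle (𝓡∂ 4) W) :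
    (Jbundle J p).proj = p.proj := rfl

omit [IsManifold (𝓡∂ 4) ∞ W] [T2Space W] in
/-- The fibre component of `Jbundle` is `J_x v`. [folklore] -/
@[simp] theorem Jbundle_snd (J : (x : W) → (E4 →L[ℝ] E4)) (p : TangentBundle (𝓡∂ 4) W) :
    (Jbundle J p).2 = J p.proj p.2 := rfl

/-- Expansion of a vector of `E4` in the standard basis. [folklore] -/
theorem sum_apply_smul_single (c : E4) : ∑ i, c i • EuclideanSpace.single i (1 : ℝ) = c := by
  simpa using (EuclideanSpace.basisFun (Fin 4) ℝ).sum_repr c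

/-- **`J` is a continuous bundle map `TW → TW`.**  In the trivialization `e` at `x₀ = p₀.proj`,
`e (x, J_x v) = (x, ∑ᵢ (e(x, v))ᵢ • JTriv J x₀ x eᵢ)`, a combination of continuous functions
(`continuousOn_JTriv`). [folklore] -/
theorem continuous_Jbundle {J : (x : W) → (E4 →L[ℝ] E4)} (hJ : PreservesSmoothFields J) :
    Continuous (Jbundle J) := by
  refine continuous_iff_continuousAt.2 fun p₀ => ?_
  set x₀ := p₀.proj with hx₀
  set e := trivializationAt E4 (TangentSpace (𝓡∂ 4)) x₀ with he
  have hp₀ : p₀.proj ∈ e.baseSet := mem_chart_source _ x₀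
  refine e.continuousAt_of_comp_left ?_ hp₀ ?_
  · exact (FiberBundle.continuous_proj E4 (TangentSpace (𝓡∂ 4))).continuousAt
  -- the formula for `e ∘ Jbundle` near `p₀`
  have hsrc : e.source ∈ 𝓝 p₀ := e.open_source.mem_nhds (e.mem_source.2 hp₀)
  have hform : ∀ p ∈ e.source, (e ∘ Jbundle J) p =
      (p.proj, ∑ i, (e p).2 i • JTriv J x₀ p.proj (EuclideanSpace.single i (1 : ℝ))) := by
    intro p hp
    have hpx : p.proj ∈ (chartAt (EuclideanHalfSpace 4) x₀).source := e.mem_source.1 hp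
    refine Prod.ext (e.coe_fst' hpx) ?_
    show (e (Jbundle J p)).2 = _
    have h1 : (e (Jbundle J p)).2 = JTriv J x₀ p.proj (e p).2 := by
      have := trivializationAt_J_apply J hpx p.2
      exact this
    rw [h1]
    conv_lhs => rw [← sum_apply_smul_single (e p).2]
    simp only [map_sum, map_smul]
  refine ContinuousAt.congr_of_eventuallyEq ?_ (Filter.eventually_of_mem hsrc hform)
  refine (FiberBundle.continuous_proj E4 (TangentSpace (𝓡∂ 4))).continuousAt.prodMk ?_
  have hterm : ∀ i, ContinuousAt (fun p : TangentBundle (𝓡∂ 4) W =>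
      (e p).2 i • JTriv J x₀ p.proj (EuclideanSpace.single i (1 : ℝ))) p₀ := fun i => by
    have hc2 : ContinuousAt (fun p : TangentBundle (𝓡∂ 4) W => (e p).2 i) p₀ :=
      (EuclideanSpace.proj i).continuous.continuousAt.comp
        (continuousAt_snd.comp (e.continuousAt (e.mem_source.2 hp₀)))
    refine hc2.smul ?_
    exact ((contMDiffAt_JTriv hJ x₀ _ hp₀).continuousAt).comp
      (FiberBundle.continuous_proj E4 (TangentSpace (𝓡∂ 4))).continuousAt
  exact tendsto_finsetSum _ fun i _ => hterm i

/-- **Continuity of `J` along continuous families of tangent vectors**: if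
`q ↦ (x q, v q) ∈ TW` is continuous within `s` at `q₀`, so is `q ↦ (x q, J_{x q} (v q))`.
[folklore] -/
theorem ContinuousWithinAt.J_bundle {J : (x : W) → (E4 →L[ℝ] E4)} (hJ : PreservesSmoothFields J)
    {P : Type*} [TopologicalSpace P] {x : P → W} {v : P → E4} {s : Set P} {q₀ : P}
    (h : ContinuousWithinAt (fun q => (TotalSpace.mk' E4 (x q) (v q) : TangentBundle (𝓡∂ 4) W)) s q₀) :
    ContinuousWithinAt
      (fun q => (TotalSpace.mk' E4 (x q) (J (x q) (v q)) : TangentBundle (𝓡∂ 4) W)) s q₀ :=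
  (continuous_Jbundle hJ).continuousAt.comp_continuousWithinAt h

/-- `ContinuousOn` version of `ContinuousWithinAt.J_bundle`. [folklore] -/
theorem ContinuousOn.J_bundle {J : (x : W) → (E4 →L[ℝ] E4)} (hJ : PreservesSmoothFields J)
    {P : Type*} [TopologicalSpace P] {x : P → W} {v : P → E4} {s : Set P}
    (h : ContinuousOn (fun q => (TotalSpace.mk' E4 (x q) (v q) : TangentBundle (𝓡∂ 4) W)) s) :
    ContinuousOn (fun q => (TotalSpace.mk' E4 (x q) (J (x q) (v q)) : TangentBundle (𝓡∂ 4) W)) s :=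
  fun q hq => ContinuousWithinAt.J_bundle hJ (h q hq)

/-- `Continuous` version of `ContinuousWithinAt.J_bundle`. [folklore] -/
theorem Continuous.J_bundle {J : (x : W) → (E4 →L[ℝ] E4)} (hJ : PreservesSmoothFields J)
    {P : Type*} [TopologicalSpace P] {x : P → W} {v : P → E4}
    (h : Continuous (fun q => (TotalSpace.mk' E4 (x q) (v q) : TangentBundle (𝓡∂ 4) W))) :
    Continuous (fun q => (TotalSpace.mk' E4 (x q) (J (x q) (v q)) : TangentBundle (𝓡∂ 4) W)) :=
  (continuous_Jbundle hJ).comp h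

end Triv

end Literature.Geometry.Symplectic

end
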